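import Summits.CriticalPhenomena.PercolationContinuityZ3.Theorems.PercNearOneGluingNoHeavyLowerTailKnQuestion8CoefficientwiseCoreClassKernelMixBundleTwoFreeze
import HarnessLib

/-!
# Chorded bundles, I: the TWO-FREEZE THEOREM WITH JOINS (honest merged schemes; the chord flip pays every collision)

Support file (`--supports stmt-CriticalPhenomena-4575`, closed), prover `prim-cplus-coupling` (gen 60).  No definitions, no notations, no named facts,
no sorries; standard axioms.  Memo `prim-cplus-coupling/A5-COUPLING-gen60.md` §2.

SETTING.  An explicit bundle `Θ(ℓ₁..ℓ_r)` as in `…KernelMixBundleBoundary` (threads `t < r`, edges `e t j`, edge sets `A t`, `E = ⋃ A t`, `C ω = C_u(ω)`)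
with a designated UNIT THREAD `c` (`L c = 1`, the chord `u b`), an up-closed event `𝒱`, monotone `{0,1}`-valued levels `hᵃ, hᵇ, kᵃ, kᵇ`; DEMAND
`b ∈ C(E∖σ) ∖ C σ`, SUPPLY `b ∈ C λ ∖ C(E∖λ)`; `bad₁ = hro ∧ kbo`, `bad₂ = kro ∧ hbo`, `L₁, L₂` as in `…KernelMixBundleTwoFreeze`, and the JOINS
`P₁ = demand ∧ hᵃX = kᵃX = 1 ∧ hᵇY = kᵇY = 0`.
* `Coefficientwise.bundle_two_freeze_joins_count` (TWO-FREEZE WITH JOINS): if the two types can be given prefix-frozen threads (a thread frozen for a type only if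
  every source of that type starts red on it) covering every thread EXCEPT the chord `c`, then `#bad₁(𝒱) + #bad₂(𝒱) ≤ #(L₁ ∪ L₂)(𝒱) + #P₁(𝒱)`.
PROOF.  The merged schemes (`bundle_merged_scheme_count`) are run on the HONEST events `𝒱ᵢ = 𝒱 ∧ (above a type-i source)`, which count the same sources; a common
landing `λ ∈ M₁ ∩ M₂` is then above a source of each type, is not fully red on any thread `≠ c`, and contains the chord; removing the chord gives a demand point
`λ ∖ A c` above both sources, hence in `P₁(𝒱)` (up-closure of `𝒱`, `hᵃ, kᵃ` increase along `σᵢ ⊆ λ∖A c`, `hᵇ, kᵇ` vanish along `E∖(λ∖A c) ⊆ E∖σᵢ`), injectively.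
So `#bad₁ + #bad₂ ≤ #M₁ + #M₂ = #(M₁ ∪ M₂) + #(M₁ ∩ M₂) ≤ #(L₁∪L₂)(𝒱) + #P₁(𝒱)`.  On `Θ(ℓ₀,ℓ₁,ℓ₂,1)` this is CASE I of the memo (exact SAT cross-checks
memo gen 60 §1–2).  [cite: KozmaNitzan2024, Questions 8–9 (§5.5 p. 36) (context); Harris 1960]
-/

namespace Summit.CriticalPhenomena.PercolationContinuityZ3.Theorems

open Finset Literature.Probability.Percolation

namespace Coefficientwise

variable {ι V : Type*}

open Classical in
/-- **TWO-FREEZE THEOREM WITH JOINS (bundles with a unit thread, all 0/1 levels, every up-set).**  Module docstring: types 1 and 2 are given named threads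
`p₁ ≠ q₁`, `p₂ ≠ q₂` with fibre flags (frozen only if every source of that type in `𝒱` starts red there) such that every thread other than the unit thread
`c` is frozen for at least one type.  Then `#bad₁(𝒱) + #bad₂(𝒱) ≤ #(L₁ ∪ L₂)(𝒱) + #P₁(𝒱)`.  Memo gen 60 §2.
[cite: KozmaNitzan2024, Questions 8–9 (§5.5 p. 36) (context); Harris 1960] -/
theorem bundle_two_freeze_joins_count (ends : ι → Sym2 V) (r : ℕ) (L : ℕ → ℕ) (hL : ∀ t, t < r → 1 ≤ L t)
    (w : ℕ → ℕ → V) (e : ℕ → ℕ → ι) (u b : V)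
    (hw0 : ∀ t, t < r → w t 0 = u) (hwL : ∀ t, t < r → w t (L t) = b)
    (harc : ∀ t, t < r → ∀ j, 1 ≤ j → j ≤ L t → ends (e t j) = s(w t (j - 1), w t j))
    (hwinj : ∀ t, t < r → ∀ i j, i ≤ L t → j ≤ L t → w t i = w t j → i = j)
    (hcross : ∀ t t', t < r → t' < r → t ≠ t' → ∀ i j, i ≤ L t → j ≤ L t' → w t i = w t' j → (i = 0 ∧ j = 0) ∨ (i = L t ∧ j = L t'))
    (A : ℕ → Finset ι) (hA : ∀ t, t < r → ∀ i, i ∈ A t ↔ ∃ j, 1 ≤ j ∧ j ≤ L t ∧ e t j = i)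
    (hAdisj : ∀ t t', t < r → t' < r → t ≠ t' → Disjoint (A t) (A t'))
    (E : Finset ι) (hEA : ∀ i, i ∈ E ↔ ∃ t, t < r ∧ i ∈ A t)
    (c : ℕ) (hc : c < r) (hLc : L c = 1)
    (p₁ q₁ : ℕ) (hp₁ : p₁ < r) (hq₁ : q₁ < r) (hpq₁ : p₁ ≠ q₁) (p₂ q₂ : ℕ) (hp₂ : p₂ < r) (hq₂ : q₂ < r) (hpq₂ : p₂ ≠ q₂)
    (𝒱 : Finset ι → Prop) (hV : ∀ ⦃s t : Finset ι⦄, s ⊆ t → 𝒱 s → 𝒱 t)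
    (ha hb ka kb : Set V → ℝ) (mha : Monotone ha) (mhb : Monotone hb) (mka : Monotone ka) (mkb : Monotone kb)
    (ha01 : ∀ S, ha S = 0 ∨ ha S = 1) (hb01 : ∀ S, hb S = 0 ∨ hb S = 1) (ka01 : ∀ S, ka S = 0 ∨ ka S = 1) (kb01 : ∀ S, kb S = 0 ∨ kb S = 1)
    (SP₁ SQ₁ SP₂ SQ₂ : Finset ℕ)
    (hSP₁ : SP₁ = {0} ∨ SP₁ = Finset.Icc 1 (L p₁ - 1)) (hSQ₁ : SQ₁ = {0} ∨ SQ₁ = Finset.Icc 1 (L q₁ - 1))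
    (hSP₂ : SP₂ = {0} ∨ SP₂ = Finset.Icc 1 (L p₂ - 1)) (hSQ₂ : SQ₂ = {0} ∨ SQ₂ = Finset.Icc 1 (L q₂ - 1))
    (cov₁P : SP₁ = Finset.Icc 1 (L p₁ - 1) → ∀ σ, σ ⊆ E →
      (𝒱 σ ∧ (b ∈ openCluster (ends '' (↑(E \ σ) : Set ι)) u ∧ b ∉ openCluster (ends '' (↑σ : Set ι)) u) ∧
        (ha (openCluster (ends '' (↑σ : Set ι)) u) = 1 ∧ hb (openCluster (ends '' (↑(E \ σ) : Set ι)) u) = 0) ∧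
        (kb (openCluster (ends '' (↑(E \ σ) : Set ι)) u) = 1 ∧ ka (openCluster (ends '' (↑σ : Set ι)) u) = 0)) → e p₁ 1 ∈ σ)
    (cov₁Q : SQ₁ = Finset.Icc 1 (L q₁ - 1) → ∀ σ, σ ⊆ E →
      (𝒱 σ ∧ (b ∈ openCluster (ends '' (↑(E \ σ) : Set ι)) u ∧ b ∉ openCluster (ends '' (↑σ : Set ι)) u) ∧
        (ha (openCluster (ends '' (↑σ : Set ι)) u) = 1 ∧ hb (openCluster (ends '' (↑(E \ σ) : Set ι)) u) = 0) ∧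
        (kb (openCluster (ends '' (↑(E \ σ) : Set ι)) u) = 1 ∧ ka (openCluster (ends '' (↑σ : Set ι)) u) = 0)) → e q₁ 1 ∈ σ)
    (cov₂P : SP₂ = Finset.Icc 1 (L p₂ - 1) → ∀ σ, σ ⊆ E →
      (𝒱 σ ∧ (b ∈ openCluster (ends '' (↑(E \ σ) : Set ι)) u ∧ b ∉ openCluster (ends '' (↑σ : Set ι)) u) ∧
        (ka (openCluster (ends '' (↑σ : Set ι)) u) = 1 ∧ kb (openCluster (ends '' (↑(E \ σ) : Set ι)) u) = 0) ∧
        (hb (openCluster (ends '' (↑(E \ σ) : Set ι)) u) = 1 ∧ ha (openCluster (ends '' (↑σ : Set ι)) u) = 0)) → e p₂ 1 ∈ σ)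
    (cov₂Q : SQ₂ = Finset.Icc 1 (L q₂ - 1) → ∀ σ, σ ⊆ E →
      (𝒱 σ ∧ (b ∈ openCluster (ends '' (↑(E \ σ) : Set ι)) u ∧ b ∉ openCluster (ends '' (↑σ : Set ι)) u) ∧
        (ka (openCluster (ends '' (↑σ : Set ι)) u) = 1 ∧ kb (openCluster (ends '' (↑(E \ σ) : Set ι)) u) = 0) ∧
        (hb (openCluster (ends '' (↑(E \ σ) : Set ι)) u) = 1 ∧ ha (openCluster (ends '' (↑σ : Set ι)) u) = 0)) → e q₂ 1 ∈ σ)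
    (hall : ∀ t, t < r → t ≠ c → (t = p₁ ∧ SP₁ = Finset.Icc 1 (L p₁ - 1)) ∨ (t = q₁ ∧ SQ₁ = Finset.Icc 1 (L q₁ - 1)) ∨
      (t = p₂ ∧ SP₂ = Finset.Icc 1 (L p₂ - 1)) ∨ (t = q₂ ∧ SQ₂ = Finset.Icc 1 (L q₂ - 1))) :
    ((E.powerset).filter (fun σ => 𝒱 σ ∧
        (b ∈ openCluster (ends '' (↑(E \ σ) : Set ι)) u ∧ b ∉ openCluster (ends '' (↑σ : Set ι)) u) ∧
        (ha (openCluster (ends '' (↑σ : Set ι)) u) = 1 ∧ hb (openCluster (ends '' (↑(E \ σ) : Set ι)) u) = 0) ∧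
        (kb (openCluster (ends '' (↑(E \ σ) : Set ι)) u) = 1 ∧ ka (openCluster (ends '' (↑σ : Set ι)) u) = 0))).card
    + ((E.powerset).filter (fun σ => 𝒱 σ ∧
        (b ∈ openCluster (ends '' (↑(E \ σ) : Set ι)) u ∧ b ∉ openCluster (ends '' (↑σ : Set ι)) u) ∧
        (ka (openCluster (ends '' (↑σ : Set ι)) u) = 1 ∧ kb (openCluster (ends '' (↑(E \ σ) : Set ι)) u) = 0) ∧
        (hb (openCluster (ends '' (↑(E \ σ) : Set ι)) u) = 1 ∧ ha (openCluster (ends '' (↑σ : Set ι)) u) = 0))).card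
    ≤ ((E.powerset).filter (fun lam => 𝒱 lam ∧
        (b ∈ openCluster (ends '' (↑lam : Set ι)) u ∧ b ∉ openCluster (ends '' (↑(E \ lam) : Set ι)) u) ∧
        ((ha (openCluster (ends '' (↑lam : Set ι)) u) = 1 ∧ kb (openCluster (ends '' (↑lam : Set ι)) u) = 1 ∧
            hb (openCluster (ends '' (↑(E \ lam) : Set ι)) u) = 0 ∧ ka (openCluster (ends '' (↑(E \ lam) : Set ι)) u) = 0) ∨
          (ka (openCluster (ends '' (↑lam : Set ι)) u) = 1 ∧ hb (openCluster (ends '' (↑lam : Set ι)) u) = 1 ∧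
            kb (openCluster (ends '' (↑(E \ lam) : Set ι)) u) = 0 ∧ ha (openCluster (ends '' (↑(E \ lam) : Set ι)) u) = 0)))).card
    + ((E.powerset).filter (fun σ => 𝒱 σ ∧
        (b ∈ openCluster (ends '' (↑(E \ σ) : Set ι)) u ∧ b ∉ openCluster (ends '' (↑σ : Set ι)) u) ∧
        (ha (openCluster (ends '' (↑σ : Set ι)) u) = 1 ∧ ka (openCluster (ends '' (↑σ : Set ι)) u) = 1 ∧
          hb (openCluster (ends '' (↑(E \ σ) : Set ι)) u) = 0 ∧ kb (openCluster (ends '' (↑(E \ σ) : Set ι)) u) = 0))).card := by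
  set C : Finset ι → Set V := fun ω => openCluster (ends '' (↑ω : Set ι)) u with hC
  -- ## bundle bookkeeping
  have hr : 0 < r := lt_of_le_of_lt (Nat.zero_le c) hc
  have hAE : ∀ t, t < r → A t ⊆ E := fun t ht i hi => (hEA i).mpr ⟨t, ht, hi⟩
  have heA : ∀ t, t < r → ∀ j, 1 ≤ j → j ≤ L t → e t j ∈ A t := fun t ht j hj1 hjL => (hA t ht _).mpr ⟨j, hj1, hjL, rfl⟩
  have full_iff : ∀ ω : Finset ι, ω ⊆ E → (b ∈ C ω ↔ ∃ t, t < r ∧ A t ⊆ ω) := fun ω hω =>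
    bundle_b_mem_cluster_iff_threads ends r L hL w e u b hr hw0 hwL harc hwinj hcross A hA E hEA ω hω
  have hAc : A c = {e c 1} := by
    ext i
    rw [hA c hc i, Finset.mem_singleton]
    constructor
    · rintro ⟨j, hj1, hjL, rfl⟩
      have : j = 1 := by rw [hLc] at hjL; omega
      rw [this]
    · intro hi; exact ⟨1, le_refl 1, by rw [hLc], hi.symm⟩
  have hecE : e c 1 ∈ E := hAE c hc (heA c hc 1 (le_refl 1) (by rw [hLc]))
  -- 0/1 bookkeeping
  have one_of_ge : ∀ (f : Set V → ℝ), (∀ S, f S = 0 ∨ f S = 1) → ∀ S S' : Set V, S ⊆ S' → Monotone f → f S = 1 → f S' = 1 := by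
    intro f f01 S S' hSS' mf h1
    rcases f01 S' with h0 | h0
    · have := mf hSS'; rw [h1, h0] at this; linarith
    · exact h0
  have zero_of_le : ∀ (f : Set V → ℝ), (∀ S, f S = 0 ∨ f S = 1) → ∀ S S' : Set V, S ⊆ S' → Monotone f → f S' = 0 → f S = 0 := by
    intro f f01 S S' hSS' mf h0
    rcases f01 S with h1 | h1
    · exact h1
    · have := mf hSS'; rw [h1, h0] at this; linarith
  have Cmono : ∀ s t : Finset ι, s ⊆ t → C s ⊆ C t := fun s t hst => openCluster_image_mono ends hst u
  have Ccompl : ∀ s t : Finset ι, s ⊆ t → C (E \ t) ⊆ C (E \ s) := fun s t hst => Cmono _ _ (Finset.sdiff_subset_sdiff (le_refl E) hst)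
  -- ## the honest events
  obtain ⟨src₁, hsrc₁⟩ : ∃ f : Finset ι → Prop, f = fun σ => σ ⊆ E ∧ 𝒱 σ ∧ (b ∈ C (E \ σ) ∧ b ∉ C σ) ∧
      (ha (C σ) = 1 ∧ hb (C (E \ σ)) = 0) ∧ (kb (C (E \ σ)) = 1 ∧ ka (C σ) = 0) := ⟨_, rfl⟩
  obtain ⟨src₂, hsrc₂⟩ : ∃ f : Finset ι → Prop, f = fun σ => σ ⊆ E ∧ 𝒱 σ ∧ (b ∈ C (E \ σ) ∧ b ∉ C σ) ∧
      (ka (C σ) = 1 ∧ kb (C (E \ σ)) = 0) ∧ (hb (C (E \ σ)) = 1 ∧ ha (C σ) = 0) := ⟨_, rfl⟩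
  obtain ⟨𝒱₁, hV₁⟩ : ∃ f : Finset ι → Prop, f = fun ξ => 𝒱 ξ ∧ ∃ σ, σ ⊆ ξ ∧ src₁ σ := ⟨_, rfl⟩
  obtain ⟨𝒱₂, hV₂⟩ : ∃ f : Finset ι → Prop, f = fun ξ => 𝒱 ξ ∧ ∃ σ, σ ⊆ ξ ∧ src₂ σ := ⟨_, rfl⟩
  have hV₁mono : ∀ ⦃s t : Finset ι⦄, s ⊆ t → 𝒱₁ s → 𝒱₁ t := by
    intro s t hst hs; rw [hV₁] at hs ⊢
    obtain ⟨hv, σ, hσs, hσ⟩ := hs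
    exact ⟨hV hst hv, σ, hσs.trans hst, hσ⟩
  have hV₂mono : ∀ ⦃s t : Finset ι⦄, s ⊆ t → 𝒱₂ s → 𝒱₂ t := by
    intro s t hst hs; rw [hV₂] at hs ⊢
    obtain ⟨hv, σ, hσs, hσ⟩ := hs
    exact ⟨hV hst hv, σ, hσs.trans hst, hσ⟩
  -- the two merged schemes on the honest events
  have k₁ := bundle_merged_scheme_count ends r L hL w e u b hw0 hwL harc hwinj hcross A hA hAdisj E hEA p₁ q₁ hp₁ hq₁ hpq₁ 𝒱₁ hV₁mono
    ha hb ka kb mha mhb mka mkb ha01 hb01 ka01 kb01 SP₁ SQ₁ hSP₁ hSQ₁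
    (fun hS σ hσ hs => cov₁P hS σ hσ ⟨(by rw [hV₁] at hs; exact hs.1.1), hs.2.1, hs.2.2.1, hs.2.2.2⟩)
    (fun hS σ hσ hs => cov₁Q hS σ hσ ⟨(by rw [hV₁] at hs; exact hs.1.1), hs.2.1, hs.2.2.1, hs.2.2.2⟩)
  have k₂ := bundle_merged_scheme_count ends r L hL w e u b hw0 hwL harc hwinj hcross A hA hAdisj E hEA p₂ q₂ hp₂ hq₂ hpq₂ 𝒱₂ hV₂mono
    ka kb ha hb mka mkb mha mhb ka01 kb01 ha01 hb01 SP₂ SQ₂ hSP₂ hSQ₂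
    (fun hS σ hσ hs => cov₂P hS σ hσ ⟨(by rw [hV₂] at hs; exact hs.1.1), hs.2.1, hs.2.2.1, hs.2.2.2⟩)
    (fun hS σ hσ hs => cov₂Q hS σ hσ ⟨(by rw [hV₂] at hs; exact hs.1.1), hs.2.1, hs.2.2.1, hs.2.2.2⟩)
  set M₁ : Finset (Finset ι) := (E.powerset).filter (fun lam => 𝒱₁ lam ∧
        (b ∈ C lam ∧ b ∉ C (E \ lam)) ∧ (ha (C lam) = 1 ∧ kb (C lam) = 1 ∧ hb (C (E \ lam)) = 0 ∧ ka (C (E \ lam)) = 0) ∧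
        (SP₁ = Finset.Icc 1 (L p₁ - 1) → e p₁ 1 ∈ lam ∧ ¬ A p₁ ⊆ lam) ∧ (SQ₁ = Finset.Icc 1 (L q₁ - 1) → e q₁ 1 ∈ lam ∧ ¬ A q₁ ⊆ lam)) with hM₁
  set M₂ : Finset (Finset ι) := (E.powerset).filter (fun lam => 𝒱₂ lam ∧
        (b ∈ C lam ∧ b ∉ C (E \ lam)) ∧ (ka (C lam) = 1 ∧ hb (C lam) = 1 ∧ kb (C (E \ lam)) = 0 ∧ ha (C (E \ lam)) = 0) ∧
        (SP₂ = Finset.Icc 1 (L p₂ - 1) → e p₂ 1 ∈ lam ∧ ¬ A p₂ ⊆ lam) ∧ (SQ₂ = Finset.Icc 1 (L q₂ - 1) → e q₂ 1 ∈ lam ∧ ¬ A q₂ ⊆ lam)) with hM₂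
  -- ## the honest events count the same sources
  have e₁ : (E.powerset).filter (fun σ => 𝒱 σ ∧ (b ∈ C (E \ σ) ∧ b ∉ C σ) ∧ (ha (C σ) = 1 ∧ hb (C (E \ σ)) = 0) ∧
      (kb (C (E \ σ)) = 1 ∧ ka (C σ) = 0)) = (E.powerset).filter (fun σ => 𝒱₁ σ ∧ (b ∈ C (E \ σ) ∧ b ∉ C σ) ∧
      (ha (C σ) = 1 ∧ hb (C (E \ σ)) = 0) ∧ (kb (C (E \ σ)) = 1 ∧ ka (C σ) = 0)) := by
    apply Finset.filter_congr
    intro σ hσ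
    rw [Finset.mem_powerset] at hσ
    constructor
    · rintro ⟨hv, hN, hh, hk⟩
      refine ⟨?_, hN, hh, hk⟩
      rw [hV₁]; exact ⟨hv, σ, le_refl σ, by rw [hsrc₁]; exact ⟨hσ, hv, hN, hh, hk⟩⟩
    · rintro ⟨hv, hN, hh, hk⟩
      rw [hV₁] at hv
      exact ⟨hv.1, hN, hh, hk⟩
  have e₂ : (E.powerset).filter (fun σ => 𝒱 σ ∧ (b ∈ C (E \ σ) ∧ b ∉ C σ) ∧ (ka (C σ) = 1 ∧ kb (C (E \ σ)) = 0) ∧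
      (hb (C (E \ σ)) = 1 ∧ ha (C σ) = 0)) = (E.powerset).filter (fun σ => 𝒱₂ σ ∧ (b ∈ C (E \ σ) ∧ b ∉ C σ) ∧
      (ka (C σ) = 1 ∧ kb (C (E \ σ)) = 0) ∧ (hb (C (E \ σ)) = 1 ∧ ha (C σ) = 0)) := by
    apply Finset.filter_congr
    intro σ hσ
    rw [Finset.mem_powerset] at hσ
    constructor
    · rintro ⟨hv, hN, hh, hk⟩
      refine ⟨?_, hN, hh, hk⟩
      rw [hV₂]; exact ⟨hv, σ, le_refl σ, by rw [hsrc₂]; exact ⟨hσ, hv, hN, hh, hk⟩⟩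
    · rintro ⟨hv, hN, hh, hk⟩
      rw [hV₂] at hv
      exact ⟨hv.1, hN, hh, hk⟩
  have b₁ : ((E.powerset).filter (fun σ => 𝒱 σ ∧ (b ∈ C (E \ σ) ∧ b ∉ C σ) ∧ (ha (C σ) = 1 ∧ hb (C (E \ σ)) = 0) ∧
      (kb (C (E \ σ)) = 1 ∧ ka (C σ) = 0))).card ≤ M₁.card := by rw [e₁]; convert k₁ using 3
  have b₂ : ((E.powerset).filter (fun σ => 𝒱 σ ∧ (b ∈ C (E \ σ) ∧ b ∉ C σ) ∧ (ka (C σ) = 1 ∧ kb (C (E \ σ)) = 0) ∧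
      (hb (C (E \ σ)) = 1 ∧ ha (C σ) = 0))).card ≤ M₂.card := by rw [e₂]; convert k₂ using 3
  -- ## landings are L₁ ∪ L₂ targets of 𝒱
  set T : Finset (Finset ι) := (E.powerset).filter (fun lam => 𝒱 lam ∧ (b ∈ C lam ∧ b ∉ C (E \ lam)) ∧
      ((ha (C lam) = 1 ∧ kb (C lam) = 1 ∧ hb (C (E \ lam)) = 0 ∧ ka (C (E \ lam)) = 0) ∨
        (ka (C lam) = 1 ∧ hb (C lam) = 1 ∧ kb (C (E \ lam)) = 0 ∧ ha (C (E \ lam)) = 0))) with hT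
  have hsub : M₁ ∪ M₂ ⊆ T := by
    intro lam hlam
    rcases Finset.mem_union.mp hlam with h | h
    · rw [hM₁, Finset.mem_filter] at h
      have hv : 𝒱 lam := by have h1 := h.2.1; rw [hV₁] at h1; exact h1.1
      exact Finset.mem_filter.mpr ⟨h.1, hv, h.2.2.1, Or.inl h.2.2.2.1⟩
    · rw [hM₂, Finset.mem_filter] at h
      have hv : 𝒱 lam := by have h1 := h.2.1; rw [hV₂] at h1; exact h1.1
      exact Finset.mem_filter.mpr ⟨h.1, hv, h.2.2.1, Or.inr h.2.2.2.1⟩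
  -- ## a common landing, with the chord removed, is a join in P₁(𝒱)
  set P : Finset (Finset ι) := (E.powerset).filter (fun σ => 𝒱 σ ∧ (b ∈ C (E \ σ) ∧ b ∉ C σ) ∧
      (ha (C σ) = 1 ∧ ka (C σ) = 1 ∧ hb (C (E \ σ)) = 0 ∧ kb (C (E \ σ)) = 0)) with hP
  -- a demand point misses the chord edge
  have src_no_chord : ∀ σ : Finset ι, σ ⊆ E → (b ∈ C (E \ σ) ∧ b ∉ C σ) → e c 1 ∉ σ := by
    intro σ hσ hN hm
    exact hN.2 ((full_iff σ hσ).mpr ⟨c, hc, by rw [hAc]; exact Finset.singleton_subset_iff.mpr hm⟩)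
  -- a supply point contains the chord edge
  have supply_chord : ∀ lam : Finset ι, lam ⊆ E → (b ∈ C lam ∧ b ∉ C (E \ lam)) → e c 1 ∈ lam := by
    intro lam hlam hR
    by_contra hm
    exact hR.2 ((full_iff (E \ lam) Finset.sdiff_subset).mpr ⟨c, hc, by
      rw [hAc]; exact Finset.singleton_subset_iff.mpr (Finset.mem_sdiff.mpr ⟨hecE, hm⟩)⟩)
  have join : ∀ lam, lam ∈ M₁ ∩ M₂ → lam \ A c ∈ P := by
    intro lam hlam
    obtain ⟨h1, h2⟩ := Finset.mem_inter.mp hlam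
    rw [hM₁, Finset.mem_filter, Finset.mem_powerset] at h1
    rw [hM₂, Finset.mem_filter, Finset.mem_powerset] at h2
    obtain ⟨hlamE, hv1, hR, -, f1P, f1Q⟩ := h1
    obtain ⟨-, hv2, -, -, f2P, f2Q⟩ := h2
    rw [hV₁] at hv1; rw [hV₂] at hv2
    obtain ⟨hv, σ₁, hσ₁lam, hs₁⟩ := hv1
    obtain ⟨-, σ₂, hσ₂lam, hs₂⟩ := hv2
    rw [hsrc₁] at hs₁; rw [hsrc₂] at hs₂
    obtain ⟨hσ₁E, hvσ₁, hN₁, hh₁, hk₁⟩ := hs₁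
    obtain ⟨hσ₂E, hvσ₂, hN₂, hh₂, hk₂⟩ := hs₂
    set ι' : Finset ι := lam \ A c with hι'
    have hι'E : ι' ⊆ E := Finset.sdiff_subset.trans hlamE
    have hσ₁ι : σ₁ ⊆ ι' := fun x hx => Finset.mem_sdiff.mpr ⟨hσ₁lam hx, fun hxc => by
      rw [hAc, Finset.mem_singleton] at hxc; subst hxc; exact src_no_chord σ₁ hσ₁E hN₁ hx⟩
    have hσ₂ι : σ₂ ⊆ ι' := fun x hx => Finset.mem_sdiff.mpr ⟨hσ₂lam hx, fun hxc => by
      rw [hAc, Finset.mem_singleton] at hxc; subst hxc; exact src_no_chord σ₂ hσ₂E hN₂ hx⟩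
    -- demand
    have hbY : b ∈ C (E \ ι') := (full_iff (E \ ι') Finset.sdiff_subset).mpr ⟨c, hc, by
      rw [hAc]; exact Finset.singleton_subset_iff.mpr (Finset.mem_sdiff.mpr ⟨hecE, fun hm => (Finset.mem_sdiff.mp hm).2 (by
        rw [hAc]; exact Finset.mem_singleton_self _)⟩)⟩
    have hbX : b ∉ C ι' := by
      intro hm
      obtain ⟨t, ht, hsubt⟩ := (full_iff ι' hι'E).mp hm
      by_cases htc : t = c
      · subst htc
        have : e t 1 ∈ ι' := hsubt (by rw [hAc]; exact Finset.mem_singleton_self _)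
        exact (Finset.mem_sdiff.mp this).2 (by rw [hAc]; exact Finset.mem_singleton_self _)
      have hsub' : A t ⊆ lam := hsubt.trans Finset.sdiff_subset
      rcases hall t ht htc with ⟨rfl, hS⟩ | ⟨rfl, hS⟩ | ⟨rfl, hS⟩ | ⟨rfl, hS⟩
      · exact (f1P hS).2 hsub'
      · exact (f1Q hS).2 hsub'
      · exact (f2P hS).2 hsub'
      · exact (f2Q hS).2 hsub'
    have hXa : ha (C ι') = 1 := one_of_ge ha ha01 _ _ (Cmono σ₁ ι' hσ₁ι) mha hh₁.1
    have hXk : ka (C ι') = 1 := one_of_ge ka ka01 _ _ (Cmono σ₂ ι' hσ₂ι) mka hh₂.1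
    have hYb : hb (C (E \ ι')) = 0 := zero_of_le hb hb01 _ _ (Ccompl σ₁ ι' hσ₁ι) mhb hh₁.2
    have hYk : kb (C (E \ ι')) = 0 := zero_of_le kb kb01 _ _ (Ccompl σ₂ ι' hσ₂ι) mkb hh₂.2
    rw [hP, Finset.mem_filter, Finset.mem_powerset]
    exact ⟨hι'E, hV hσ₁ι hvσ₁, ⟨hbY, hbX⟩, hXa, hXk, hYb, hYk⟩
  have inj : Set.InjOn (fun lam : Finset ι => lam \ A c) ↑(M₁ ∩ M₂) := by
    intro lam hlam lam' hlam' heq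
    have h1 := (Finset.mem_inter.mp (Finset.mem_coe.mp hlam)).1
    have h1' := (Finset.mem_inter.mp (Finset.mem_coe.mp hlam')).1
    rw [hM₁, Finset.mem_filter, Finset.mem_powerset] at h1 h1'
    have hc1 : A c ⊆ lam := by rw [hAc]; exact Finset.singleton_subset_iff.mpr (supply_chord lam h1.1 h1.2.2.1)
    have hc1' : A c ⊆ lam' := by rw [hAc]; exact Finset.singleton_subset_iff.mpr (supply_chord lam' h1'.1 h1'.2.2.1)
    have := congrArg (fun s : Finset ι => s ∪ A c) heq
    simp only at this
    rwa [Finset.sdiff_union_of_subset hc1, Finset.sdiff_union_of_subset hc1'] at this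
  have cP : (M₁ ∩ M₂).card ≤ P.card :=
    Finset.card_le_card_of_injOn (fun lam => lam \ A c) (fun lam hlam => join lam hlam) inj
  -- ## assembly
  have eU := Finset.card_union_add_card_inter M₁ M₂
  have cU := Finset.card_le_card hsub
  calc _ ≤ M₁.card + M₂.card := Nat.add_le_add b₁ b₂
    _ = (M₁ ∪ M₂).card + (M₁ ∩ M₂).card := eU.symm
    _ ≤ T.card + P.card := Nat.add_le_add cU cP

end Coefficientwise

end Summit.CriticalPhenomena.PercolationContinuityZ3.Theorems
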